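import Literature.Analysis.FunctionSpaces.KantorovichLogDistance
import Literature.Analysis.FunctionSpaces.TorusMollifierEstimates
import Literature.Analysis.FunctionSpaces.TorusHolderBridge
import HarnessLib

/-!
# The Kantorovich–Sobolev interpolation inequality (Seis 2022, Lemma 4)

Analysis/FunctionSpaces support file (everything proved). It serves the discharge of the named
facts `Literature.Analysis.FluidPDE.Seis2022_rmk1_L2` / `Seis2022_thm2_L2`
(`FluidPDE/SeisDissipationRateBound`).

**Seis 2022, Lemma 4** (arXiv:2003.08794, p. 7). *Let `θ` be a mean zero function in
`W^{1,1}(T^d)`. Then there exists a constant `C > 0` such that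
`D_δ(θ) ≳ log(‖θ‖_{L¹} / (δ C ‖∇θ‖_{L¹}) + 1) ‖θ‖_{L¹}`.*

Here `D_δ` is the Kantorovich–Rubinstein distance with logarithmic cost, taken in the tree in
its dual form `Torus.krLogDist` (`KantorovichLogDistance`). We prove the lemma with explicit
constants and with the Sobolev seminorm replaced by what the printed proof actually uses, an
`L¹` translation modulus `‖θ(· - y) - θ‖_{L¹} ≤ g ‖y‖` (for `C¹` functions `g = √d ‖∇θ‖_{L¹}`
will do, `Torus.eLpNorm_comp_sub_sub_le_of_isContDiff`):

`Torus.krLogDist_ge_of_translation`: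
`(‖θ‖₁/8) · log(1 + min(‖θ‖₁/g, 1) / (C_d δ)) ≤ krLogDist δ θ`, `C_d = Torus.lemma4Const d =
4 √d · d · C₁` (`C₁ = Torus.gradProfileMass d`, the gradient mass of the standard mollifier).
The `min(·, 1)` only reflects the constraint `R ≤ 1/4` on mollification scales on the unit torus;
for mean-zero `θ` one has `‖θ‖₁ ≲ g` anyway.

Printed proof (p. 7), followed line by line in dual form: `‖θ‖₁ = ∫ θ ψ` with `ψ = sgn θ`;
split `∫ θψ = ∫ θ(ψ - ψ_R) + ∫ θ ψ_R` with `ψ_R = ψ ⋆ k_R`; the first term is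
`∫ (θ - θ ⋆ k_R) ψ ≤ ‖θ ⋆ k_R - θ‖₁ ≤ g R` (evenness of the kernel, CET (6) of
`TorusMollifierEstimates`); for the second, `ψ_R` is `A/R`-Lipschitz (`A = √d · d · C₁`) and
bounded by `1`, so `ψ_R x - ψ_R y ≤ (2/c(r)) c_δ(x,y) + A r/R` (case distinction `dist ≤ r` /
`> r`, monotonicity of the logarithm), whence by the envelope lemma
(`Torus.integral_mul_le_krLogDist_add`, the dual replacement of splitting a transport plan at
`|x-y| = r`) `∫ θ ψ_R ≤ (2/c(r)) krLogDist + ‖θ‖₁ A r/(2R)`; choose `R = A r` and then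
`r = ‖θ‖₁/(4 g A)` (or `R = 1/4` when `‖θ‖₁ > g`).

## References

* C. Seis, *Bounds on the rate of enhanced dissipation*, Comm. Math. Phys. 399 (2023) =
  arXiv:2003.08794, Lemma 4 and its proof (p. 7). [`Seis2022`]
* Y. Brenier, F. Otto, C. Seis, SIAM J. Math. Anal. 43 (2011), 114–134 (the original
  interpolation between logarithmic Kantorovich distances and `BV`/Sobolev norms).
-/

noncomputable section

open MeasureTheory Set Filter Metric Function
open scoped Topology Convolution ENNReal

namespace Literature.Analysis.FunctionSpaces

namespace Torus

variable {d : Type*} [Fintype d]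

/-! ## The sign test function and its mollification -/

/-- The sign test function `ψ = 1` on `{θ ≥ 0}`, `-1` on `{θ < 0}` (so that `θ ψ = |θ|`). [folklore] -/
def signTest (θ : UnitAddTorus d → ℝ) (x : UnitAddTorus d) : ℝ :=
  if 0 ≤ θ x then 1 else -1

omit [Fintype d] in
/-- `θ x · ψ x = |θ x|`. [folklore] -/
theorem mul_signTest (θ : UnitAddTorus d → ℝ) (x : UnitAddTorus d) : θ x * signTest θ x = |θ x| := by
  unfold signTest
  split_ifs with h
  · rw [mul_one, abs_of_nonneg h]
  · rw [mul_neg_one, abs_of_neg (not_le.1 h)]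

omit [Fintype d] in
/-- `|ψ x| ≤ 1`. [folklore] -/
theorem abs_signTest_le_one (θ : UnitAddTorus d → ℝ) (x : UnitAddTorus d) : |signTest θ x| ≤ 1 := by
  unfold signTest
  split_ifs <;> simp

omit [Fintype d] in
/-- The sign test function of a measurable function is measurable. [folklore] -/
theorem measurable_signTest {θ : UnitAddTorus d → ℝ} (hθ : Measurable θ) : Measurable (signTest θ) :=
  Measurable.ite (measurableSet_le measurable_const hθ) measurable_const measurable_const

/-- The sign test function is integrable (bounded, on a probability space). [folklore] -/
theorem integrable_signTest {θ : UnitAddTorus d → ℝ} (hθ : Measurable θ) :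
    Integrable (signTest θ) volume :=
  (integrable_const (1 : ℝ)).mono' (measurable_signTest hθ).aestronglyMeasurable
    (Eventually.of_forall fun x => by simpa [Real.norm_eq_abs] using abs_signTest_le_one θ x)

/-- A mollification of a function bounded by `1` is bounded by `1` (the kernel is a probability
density). [folklore] -/
theorem abs_convolution_kernel_le_one {ψ : UnitAddTorus d → ℝ} (hψi : Integrable ψ volume)
    (hψ : ∀ x, |ψ x| ≤ 1) {R : ℝ} (hR : 0 < R) (hR' : R ≤ 1 / 4) (x : UnitAddTorus d) :
    |(ψ ⋆ kernel R) x| ≤ 1 := by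
  have hk := continuous_kernel (d := d) hR hR'
  have hkx : Integrable (fun y => kernel R (x - y)) volume :=
    (hk.comp (continuous_const.sub continuous_id)).integrable_unitAddTorus
  rw [convolution_lsmul]
  simp only [smul_eq_mul]
  calc |∫ y, ψ y * kernel R (x - y)| ≤ ∫ y, |ψ y * kernel R (x - y)| := abs_integral_le_integral_abs
    _ ≤ ∫ y, kernel R (x - y) := by
        refine integral_mono (integrable_smul_comp_sub hψi hk x).abs hkx fun y => ?_
        show |ψ y * kernel R (x - y)| ≤ kernel R (x - y)
        rw [abs_mul, abs_of_nonneg (kernel_nonneg hR.le _)]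
        exact mul_le_of_le_one_left (kernel_nonneg hR.le _) (hψ y)
    _ = 1 := by rw [integral_sub_left_eq_self (fun y => kernel R y) volume x, integral_kernel hR hR']

variable [DecidableEq d] in
/-- Partial derivatives of a mollification of a function bounded by `1`:
`|∂ⱼ(ψ ⋆ k_R)| ≤ C₁/R`. [folklore] -/
theorem abs_partialDeriv_convolution_kernel_le_of_abs_le_one {ψ : UnitAddTorus d → ℝ}
    (hψi : Integrable ψ volume) (hψ : ∀ x, |ψ x| ≤ 1) {R : ℝ} (hR : 0 < R) (hR' : R ≤ 1 / 4)
    (j : d) (x : UnitAddTorus d) :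
    |partialDeriv j (ψ ⋆ kernel R) x| ≤ R⁻¹ * gradProfileMass d := by
  have hk := isSmooth_kernel (d := d) hR hR'
  have hkj : Continuous (partialDeriv j (kernel (d := d) R)) := (hk.partialDeriv j).continuous
  have hkx : Integrable (fun y => |partialDeriv j (kernel R) (x - y)|) volume :=
    (continuous_abs.comp (hkj.comp (continuous_const.sub continuous_id))).integrable_unitAddTorus
  rw [partialDeriv_convolution hψi hk, convolution_lsmul]
  simp only [smul_eq_mul]
  calc |∫ y, ψ y * partialDeriv j (kernel R) (x - y)|
      ≤ ∫ y, |ψ y * partialDeriv j (kernel R) (x - y)| := abs_integral_le_integral_abs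
    _ ≤ ∫ y, |partialDeriv j (kernel R) (x - y)| := by
        refine integral_mono (integrable_smul_comp_sub hψi hkj x).abs hkx fun y => ?_
        show |ψ y * partialDeriv j (kernel R) (x - y)| ≤ |partialDeriv j (kernel R) (x - y)|
        rw [abs_mul]
        exact mul_le_of_le_one_left (abs_nonneg _) (hψ y)
    _ = ∫ y, |partialDeriv j (kernel R) y| :=
        integral_sub_left_eq_self (fun y => |partialDeriv j (kernel R) y|) volume x
    _ ≤ R⁻¹ * gradProfileMass d := by
        have h := lintegral_enorm_partialDeriv_kernel_le (d := d) hR hR' j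
        have hi : Integrable (partialDeriv j (kernel (d := d) R)) volume := hkj.integrable_unitAddTorus
        rw [← ofReal_integral_norm_eq_lintegral_enorm hi] at h
        have h0 : 0 ≤ R⁻¹ * gradProfileMass d := mul_nonneg (inv_nonneg.2 hR.le) (gradProfileMass_nonneg (d := d))
        simpa [Real.norm_eq_abs, ENNReal.ofReal_le_ofReal_iff h0] using h

/-- The Lipschitz constant numerator `A = √d · d · C₁` of mollified unit-bounded functions:
`ψ ⋆ k_R` is `A/R`-Lipschitz when `|ψ| ≤ 1`. [folklore] -/
def lipConst (d : Type*) [Fintype d] : ℝ :=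
  Real.sqrt (Fintype.card d) * (Fintype.card d * gradProfileMass d)

/-- `0 ≤ A`. [folklore] -/
theorem lipConst_nonneg (d : Type*) [Fintype d] : 0 ≤ lipConst d :=
  mul_nonneg (Real.sqrt_nonneg _) (mul_nonneg (Nat.cast_nonneg _) (gradProfileMass_nonneg (d := d)))

/-- **Lipschitz bound for mollified unit-bounded functions**: if `|ψ| ≤ 1` then
`|(ψ ⋆ k_R) x - (ψ ⋆ k_R) y| ≤ (A/R) dist x y`. [folklore] -/
theorem abs_convolution_kernel_sub_le {ψ : UnitAddTorus d → ℝ} (hψi : Integrable ψ volume)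
    (hψ : ∀ x, |ψ x| ≤ 1) {R : ℝ} (hR : 0 < R) (hR' : R ≤ 1 / 4) (x y : UnitAddTorus d) :
    |(ψ ⋆ kernel R) x - (ψ ⋆ kernel R) y| ≤ lipConst d / R * dist x y := by
  classical
  have hk := isSmooth_kernel (d := d) hR hR'
  have h1 : IsContDiff 1 (ψ ⋆ kernel R) := (isSmooth_convolution hψi hk).isContDiff (by simp)
  set M : d → NNReal := fun _ => ⟨R⁻¹ * gradProfileMass d,
    mul_nonneg (inv_nonneg.2 hR.le) (gradProfileMass_nonneg (d := d))⟩ with hM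
  have hL := lipschitzWith_of_norm_partialDeriv_le h1 (M := M) fun i z => by
    rw [Real.norm_eq_abs]
    exact abs_partialDeriv_convolution_kernel_le_of_abs_le_one hψi hψ hR hR' i z
  have h := hL.dist_le_mul x y
  rw [Real.dist_eq] at h
  have hsum : ((∑ i, M i : NNReal) : ℝ) = Fintype.card d * (R⁻¹ * gradProfileMass d) := by
    rw [NNReal.coe_sum]
    simp [hM, Finset.sum_const, Finset.card_univ]
    exact Or.inl rfl
  have hsq : ((NNReal.sqrt (Fintype.card d) : NNReal) : ℝ) = Real.sqrt (Fintype.card d) := by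
    simp
  have hcoe : ((NNReal.sqrt (Fintype.card d) * ∑ i, M i : NNReal) : ℝ) = lipConst d / R := by
    rw [NNReal.coe_mul, hsum, hsq, lipConst]
    field_simp
  rw [hcoe] at h
  exact h

/-- **Moving the (even) kernel across**: `∫ θ · (ψ ⋆ k_R) = ∫ (θ ⋆ k_R) · ψ` for `θ ∈ L¹` and
bounded measurable `ψ` (Fubini and `k_R(x - y) = k_R(y - x)`). [folklore] -/
theorem integral_mul_convolution_kernel_comm {θ ψ : UnitAddTorus d → ℝ} (hθ : Integrable θ volume)
    (hθm : Measurable θ) (hψm : Measurable ψ) (hψ : ∀ x, |ψ x| ≤ 1) {R : ℝ} (hR : 0 < R)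
    (hR' : R ≤ 1 / 4) :
    ∫ x, θ x * (ψ ⋆ kernel R) x = ∫ y, (θ ⋆ kernel R) y * ψ y := by
  have hk := continuous_kernel (d := d) hR hR'
  obtain ⟨C, hC⟩ := exists_forall_norm_le_of_continuous hk
  have hψi : Integrable ψ volume := (integrable_const (1 : ℝ)).mono' hψm.aestronglyMeasurable
    (Eventually.of_forall fun x => by simpa [Real.norm_eq_abs] using hψ x)
  -- the joint integrand `θ x ψ y k(x - y)` is integrable on `T^d × T^d`
  have hF : Integrable (fun p : UnitAddTorus d × UnitAddTorus d => θ p.1 * (ψ p.2 * kernel R (p.1 - p.2)))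
      (volume.prod volume) := by
    refine Integrable.mono' ((hθ.abs.mul_prod (integrable_const C)))
      ((hθm.comp measurable_fst).mul ((hψm.comp measurable_snd).mul
        (hk.measurable.comp (measurable_fst.sub measurable_snd)))).aestronglyMeasurable
      (Eventually.of_forall fun p => ?_)
    rw [Real.norm_eq_abs, abs_mul, abs_mul]
    refine mul_le_mul_of_nonneg_left ?_ (abs_nonneg _)
    calc |ψ p.2| * |kernel R (p.1 - p.2)| ≤ 1 * C :=
          mul_le_mul (hψ _) (by simpa [Real.norm_eq_abs] using hC (p.1 - p.2)) (abs_nonneg _) zero_le_one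
      _ = C := one_mul C
  calc ∫ x, θ x * (ψ ⋆ kernel R) x = ∫ x, ∫ y, θ x * (ψ y * kernel R (x - y)) := by
        refine integral_congr_ae (Eventually.of_forall fun x => ?_)
        simp only [convolution_lsmul, smul_eq_mul, ← integral_const_mul]
    _ = ∫ y, ∫ x, θ x * (ψ y * kernel R (x - y)) := integral_integral_swap hF
    _ = ∫ y, (θ ⋆ kernel R) y * ψ y := by
        refine integral_congr_ae (Eventually.of_forall fun y => ?_)
        simp only [convolution_lsmul, smul_eq_mul, ← integral_mul_const]
        refine integral_congr_ae (Eventually.of_forall fun x => ?_)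
        show θ x * (ψ y * kernel R (x - y)) = θ x * kernel R (y - x) * ψ y
        rw [kernel_sub_comm hR hR' x y]
        ring

/-! ## The interpolation inequality -/

/-- The mollification error in `L¹` from a linear translation modulus:
`∫ |θ ⋆ k_R - θ| ≤ g R` if `‖θ(· - y) - θ‖_{L¹} ≤ g ‖y‖` for all `y` (CET (6)). [folklore] -/
theorem integral_abs_convolution_kernel_sub_self_le {θ : UnitAddTorus d → ℝ} (hθ : Integrable θ volume)
    {g : ℝ} (hg : 0 ≤ g)
    (hmod : ∀ y : UnitAddTorus d, eLpNorm (fun x => θ (x - y) - θ x) 1 volume ≤ ENNReal.ofReal (g * ‖y‖))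
    {R : ℝ} (hR : 0 < R) (hR' : R ≤ 1 / 4) :
    ∫ x, |(θ ⋆ kernel R) x - θ x| ≤ g * R := by
  have hk := continuous_kernel (d := d) hR hR'
  have hi : Integrable (θ ⋆ kernel R - θ) volume := (continuous_convolution hθ hk).integrable_unitAddTorus.sub hθ
  have h := eLpNorm_convolution_kernel_sub_self_le hθ hR hR' le_rfl ENNReal.one_ne_top
    (A := ENNReal.ofReal (g * R)) fun y hy => (hmod y).trans (ENNReal.ofReal_le_ofReal (by nlinarith))
  rw [eLpNorm_one_eq_lintegral_enorm, ← ofReal_integral_norm_eq_lintegral_enorm hi,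
    ENNReal.ofReal_le_ofReal_iff (by positivity)] at h
  simpa [Real.norm_eq_abs] using h

/-- The constant `C_d = 4 √d · d · C₁` of the tree's form of Seis 2022, Lemma 4. [folklore] -/
def lemma4Const (d : Type*) [Fintype d] : ℝ :=
  4 * lipConst d

/-- `0 ≤ C_d`. [folklore] -/
theorem lemma4Const_nonneg (d : Type*) [Fintype d] : 0 ≤ lemma4Const d :=
  mul_nonneg (by norm_num) (lipConst_nonneg d)

/-- **The core estimate of the proof of Seis 2022, Lemma 4** (p. 7, the display before
"Maximizing in `ψ`"): for mean-zero `θ ∈ L¹(T^d)` with translation modulus `g`, all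
`0 < r` and `0 < R ≤ 1/4`,
`‖θ‖₁ ≤ g R + (A r / (2R)) ‖θ‖₁ + (2 / log(1 + r/δ)) · krLogDist δ θ`. [cite: Seis2022, Lemma 4 (proof, p. 7)] -/
theorem integral_abs_le_of_translation {δ : ℝ} (hδ : 0 < δ) {θ : UnitAddTorus d → ℝ}
    (hθ : Integrable θ volume) (hθm : Measurable θ) (h0 : ∫ x, θ x = 0) {g : ℝ} (hg : 0 ≤ g)
    (hmod : ∀ y : UnitAddTorus d, eLpNorm (fun x => θ (x - y) - θ x) 1 volume ≤ ENNReal.ofReal (g * ‖y‖))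
    {r R : ℝ} (hr : 0 < r) (hR : 0 < R) (hR' : R ≤ 1 / 4) :
    ∫ x, |θ x| ≤ g * R + lipConst d * r / (2 * R) * (∫ x, |θ x|) +
      2 / Real.log (1 + r / δ) * krLogDist δ θ := by
  set ψ := signTest θ with hψdef
  set ψR := ψ ⋆ kernel R with hψR
  have hψm : Measurable ψ := measurable_signTest hθm
  have hψ1 : ∀ x, |ψ x| ≤ 1 := abs_signTest_le_one θ
  have hψi : Integrable ψ volume := integrable_signTest hθm
  have hk := continuous_kernel (d := d) hR hR'
  have hks := isSmooth_kernel (d := d) hR hR'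
  have hψRc : Continuous ψR := continuous_convolution hψi hk
  have hθk : Continuous (θ ⋆ kernel R) := continuous_convolution hθ hk
  set m := ∫ x, |θ x| with hm
  set L := lipConst d / R with hL
  set cr := Real.log (1 + r / δ) with hcr
  have hcr0 : 0 < cr := Real.log_pos (by have := div_pos hr hδ; linarith)
  have hL0 : 0 ≤ L := div_nonneg (lipConst_nonneg d) hR.le
  -- (13): `m = ∫ θψ = ∫ θ(ψ - ψ_R) + ∫ θ ψ_R`
  have hθψ : Integrable (fun x => θ x * ψ x) volume :=
    hθ.mul_bdd hψm.aestronglyMeasurable (Eventually.of_forall fun x => by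
      simpa [Real.norm_eq_abs] using hψ1 x)
  have hθψR : Integrable (fun x => θ x * ψR x) volume :=
    hθ.mul_bdd hψRc.aestronglyMeasurable (Eventually.of_forall fun x => by
      simpa [Real.norm_eq_abs, hψR] using abs_convolution_kernel_le_one hψi hψ1 hR hR' x)
  have em : m = ∫ x, θ x * ψ x := by
    simp_rw [hm, hψdef, mul_signTest]
  -- (14): the first term is at most `‖θ ⋆ k_R - θ‖₁ ≤ g R`
  have h14 : (∫ x, θ x * ψ x) - ∫ x, θ x * ψR x ≤ g * R := by
    have hswap : ∫ x, θ x * ψR x = ∫ y, (θ ⋆ kernel R) y * ψ y :=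
      integral_mul_convolution_kernel_comm hθ hθm hψm hψ1 hR hR'
    have hθkψ : Integrable (fun y => (θ ⋆ kernel R) y * ψ y) volume :=
      hθk.integrable_unitAddTorus.mul_bdd hψm.aestronglyMeasurable
        (Eventually.of_forall fun x => by simpa [Real.norm_eq_abs] using hψ1 x)
    rw [hswap, ← integral_sub hθψ hθkψ]
    calc ∫ y, (θ y * ψ y - (θ ⋆ kernel R) y * ψ y) ≤ ∫ y, |(θ ⋆ kernel R) y - θ y| := by
          refine integral_mono (hθψ.sub hθkψ) ((hθk.integrable_unitAddTorus.sub hθ).abs) fun y => ?_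
          show θ y * ψ y - (θ ⋆ kernel R) y * ψ y ≤ |(θ ⋆ kernel R) y - θ y|
          calc θ y * ψ y - (θ ⋆ kernel R) y * ψ y = -(((θ ⋆ kernel R) y - θ y) * ψ y) := by ring
            _ ≤ |((θ ⋆ kernel R) y - θ y) * ψ y| := neg_le_abs _
            _ = |(θ ⋆ kernel R) y - θ y| * |ψ y| := abs_mul _ _
            _ ≤ |(θ ⋆ kernel R) y - θ y| := mul_le_of_le_one_right (abs_nonneg _) (hψ1 y)
      _ ≤ g * R := integral_abs_convolution_kernel_sub_self_le hθ hg hmod hR hR'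
  -- the second term: `ψ_R x - ψ_R y ≤ (2/c(r)) c_δ(x,y) + L r`, envelope lemma
  have h15 : ∫ x, θ x * ψR x ≤ 2 / cr * krLogDist δ θ + L * r / 2 * m := by
    -- rescale: `f = (cr/2) ψ_R`, constant defect `Φ₀ = (cr/2) L r / 2`
    set f : UnitAddTorus d → ℝ := fun x => cr / 2 * ψR x with hf
    set Φ₀ : ℝ := cr / 2 * (L * r / 2) with hΦ₀
    have hfi : Integrable (fun x => θ x * f x) volume := by
      have : (fun x => θ x * f x) = fun x => cr / 2 * (θ x * ψR x) := by
        funext x; simp only [hf]; ring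
      rw [this]
      exact hθψR.const_mul _
    have hΦi : Integrable (fun x => |θ x| * Φ₀) volume := hθ.abs.mul_const _
    have htwo : ∀ x y, f x - f y ≤ logCost δ x y + Φ₀ + Φ₀ := by
      intro x y
      have hdiff : ψR x - ψR y ≤ L * dist x y := by
        have := abs_convolution_kernel_sub_le hψi hψ1 hR hR' x y
        rw [← hψR, ← hL] at this
        exact (le_abs_self _).trans this
      have hc0 := logCost_nonneg hδ x y
      rcases le_or_gt (dist x y) r with hxy | hxy
      · -- close points: the Lipschitz bound
        have h1 : f x - f y ≤ cr / 2 * (L * r) := by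
          have : f x - f y = cr / 2 * (ψR x - ψR y) := by simp only [hf]; ring
          rw [this]
          exact mul_le_mul_of_nonneg_left (hdiff.trans (mul_le_mul_of_nonneg_left hxy hL0)) (by positivity)
        have e : cr / 2 * (L * r) = Φ₀ + Φ₀ := by simp only [hΦ₀]; ring
        linarith
      · -- distant points: `f x - f y ≤ cr ≤ c_δ(x,y)`
        have hb : ψR x - ψR y ≤ 2 := by
          have hx := abs_convolution_kernel_le_one hψi hψ1 hR hR' x
          have hy := abs_convolution_kernel_le_one hψi hψ1 hR hR' y
          rw [← hψR] at hx hy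
          linarith [(abs_le.1 hx).2, (abs_le.1 hy).1]
        have h1 : f x - f y ≤ cr := by
          have : f x - f y = cr / 2 * (ψR x - ψR y) := by simp only [hf]; ring
          rw [this]
          nlinarith
        have h2 : cr ≤ logCost δ x y := by
          rw [hcr, logCost]
          exact Real.log_le_log (by positivity) (by gcongr)
        have hΦ00 : 0 ≤ Φ₀ := by positivity
        linarith
    have key := integral_mul_le_krLogDist_add hδ hθ h0 (G := univ) (Eventually.of_forall mem_univ)
      (fun x _ y _ => htwo x y) hfi hΦi
    have e1 : ∫ x, θ x * f x = cr / 2 * ∫ x, θ x * ψR x := by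
      rw [← integral_const_mul]
      refine integral_congr_ae (Eventually.of_forall fun x => ?_)
      simp only [hf]; ring
    have e2 : ∫ x, |θ x| * Φ₀ = Φ₀ * m := by rw [integral_mul_const, hm, mul_comm]
    rw [e1, e2, hΦ₀] at key
    -- divide by `cr/2 > 0`
    have hcr2 : 0 < cr / 2 := by positivity
    refine le_of_mul_le_mul_left ?_ hcr2
    calc cr / 2 * ∫ x, θ x * ψR x ≤ krLogDist δ θ + cr / 2 * (L * r / 2) * m := key
      _ = cr / 2 * (2 / cr * krLogDist δ θ + L * r / 2 * m) := by field_simp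
  have e3 : L * r / 2 * m = lipConst d * r / (2 * R) * m := by
    simp only [hL]; field_simp
  linarith [em, h14, h15, e3]

/-- **Seis 2022, Lemma 4 (Kantorovich–Sobolev interpolation), tree form.** For `δ > 0`, a
mean-zero `θ ∈ L¹(T^d)` and `g > 0` with `‖θ(· - y) - θ‖_{L¹} ≤ g ‖y‖` for all `y ∈ T^d`:
`(‖θ‖₁ / 8) · log(1 + min(‖θ‖₁/g, 1) / (C_d δ)) ≤ krLogDist δ θ`, `C_d = lemma4Const d`.
This is the printed `D_δ(θ) ≳ log(‖θ‖₁/(δ C ‖∇θ‖₁) + 1) ‖θ‖₁` with `‖∇θ‖_{L¹}` replaced by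
the translation modulus `g` it is used through, explicit constants, and the harmless cap
`min(·,1)` coming from the restriction `R ≤ 1/4` on mollification scales on the unit torus.
[cite: Seis2022, Lemma 4 (p. 7)] -/
theorem krLogDist_ge_of_translation {δ : ℝ} (hδ : 0 < δ) {θ : UnitAddTorus d → ℝ}
    (hθ : Integrable θ volume) (hθm : Measurable θ) (h0 : ∫ x, θ x = 0) {g : ℝ} (hg : 0 < g)
    (hmod : ∀ y : UnitAddTorus d, eLpNorm (fun x => θ (x - y) - θ x) 1 volume ≤ ENNReal.ofReal (g * ‖y‖)) :
    (∫ x, |θ x|) / 8 * Real.log (1 + min ((∫ x, |θ x|) / g) 1 / (lemma4Const d * δ)) ≤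
      krLogDist δ θ := by
  set m := ∫ x, |θ x| with hm
  have hm0 : 0 ≤ m := integral_nonneg fun x => abs_nonneg _
  have hKR0 := krLogDist_nonneg hδ hθ h0
  set A := lipConst d with hA
  have hA0 : 0 ≤ A := lipConst_nonneg d
  -- degenerate constants: the right-hand side vanishes
  rcases hA0.eq_or_lt with hA00 | hApos
  · have : lemma4Const d = 0 := by rw [lemma4Const, ← hA, ← hA00, mul_zero]
    rw [this, zero_mul, div_zero, add_zero, Real.log_one, mul_zero]
    exact hKR0
  rcases hm0.eq_or_lt with hm00 | hmpos
  · rw [← hm00, zero_div, zero_mul]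
    exact hKR0
  have hC : lemma4Const d = 4 * A := rfl
  by_cases hmg : m ≤ g
  · -- `R = m/(4g) ≤ 1/4`, `r = R/A`
    have hmin : min (m / g) 1 = m / g := min_eq_left ((div_le_one hg).2 hmg)
    set R := m / (4 * g) with hR
    set r := R / A with hr
    have hR0 : 0 < R := by positivity
    have hR' : R ≤ 1 / 4 := by
      rw [hR, div_le_div_iff₀ (by positivity) (by norm_num : (0 : ℝ) < 4)]
      linarith
    have hr0 : 0 < r := by positivity
    have key := integral_abs_le_of_translation hδ hθ hθm h0 hg.le hmod hr0 hR0 hR'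
    rw [← hm, ← hA] at key
    have e1 : g * R = m / 4 := by simp only [hR]; field_simp
    have e2 : A * r / (2 * R) * m = m / 2 := by simp only [hr]; field_simp
    have e3 : r / δ = min (m / g) 1 / (lemma4Const d * δ) := by
      rw [hmin, hC, hr, hR]
      field_simp
    rw [e1, e2] at key
    have hcr0 : 0 < Real.log (1 + r / δ) := Real.log_pos (by have := div_pos hr0 hδ; linarith)
    -- `m/4 ≤ (2 / c(r)) krLogDist`
    have h4 : m / 4 * Real.log (1 + r / δ) ≤ 2 * krLogDist δ θ := by
      have : m / 4 ≤ 2 / Real.log (1 + r / δ) * krLogDist δ θ := by linarith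
      rw [div_mul_eq_mul_div, le_div_iff₀ hcr0] at this
      linarith
    rw [← e3]
    linarith
  · -- `R = 1/4`, `r = R/A`
    have hmg' : g < m := lt_of_not_ge hmg
    have hmin : min (m / g) 1 = 1 := min_eq_right ((one_le_div hg).2 hmg'.le)
    set R : ℝ := 1 / 4 with hR
    set r := R / A with hr
    have hR0 : 0 < R := by norm_num
    have hr0 : 0 < r := by positivity
    have key := integral_abs_le_of_translation hδ hθ hθm h0 hg.le hmod hr0 hR0 le_rfl
    rw [← hm, ← hA] at key
    have e2 : A * r / (2 * R) * m = m / 2 := by simp only [hr]; field_simp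
    have e3 : r / δ = min (m / g) 1 / (lemma4Const d * δ) := by
      rw [hmin, hC, hr, hR]
      field_simp
    rw [e2] at key
    have hcr0 : 0 < Real.log (1 + r / δ) := Real.log_pos (by have := div_pos hr0 hδ; linarith)
    have h4 : m / 4 * Real.log (1 + r / δ) ≤ 2 * krLogDist δ θ := by
      have : m / 4 ≤ 2 / Real.log (1 + r / δ) * krLogDist δ θ := by
        have : g * R < m / 4 := by rw [hR]; linarith
        linarith
      rw [div_mul_eq_mul_div, le_div_iff₀ hcr0] at this
      linarith
    rw [← e3]
    linarith

end Torus

end Literature.Analysis.FunctionSpaces
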